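import Summits.QuantumFields.BalabanUV.T4Continuum.Spine.NE1p.B7AveragingCurvedBackgroundGauge
import Literature.MathematicalPhysics.QuantumFieldTheory.Balaban1983to89.B7Prop1Local

/-!
# T⁴ programme, spine estimate NE1′ (node O3b/H2) — DOOR (c) AT LEVEL 1, BLOCK-LOCAL FORM: the quadratic term of the covariant
# block-average logarithm is determined by the slot and the background ON THE BLOCK PAIR `B(c₋) ∪ B(c₊)` (p. 24 locality), and for a
# background with small plaquette variables THERE — the printed hypothesis (44), local — it is `≲ a²·sup_{p ⊂ B(c₋)∪B(c₊)} ‖U₀(∂p) − 1‖`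
# for one-site commuting slots (axial gauge p. 24 ∕ (45) + files 16∕17)

Cell `pub-balaban-gaps` (YM blitz Y1, track G2), seat `ne1` gen 11 (prover-pub-balaban-gaps-ne1-g11-0); record `HOME/ne/NE1.md` v11 §4 R64.
ADDITIVE — imports this seat's `B7AveragingCurvedBackgroundGauge` (gen 10, files 16∕17) and the b07 lineage's `B7Prop1Local` (the KERNEL
p. 24 locality «`Ū_c` depends only on `U_b`, `b ⊂ B(c₋) ∪ B(c₊)`»: `AgreeOn`, `InBox`, `bondHi`, `bavg_congr`, `clampCfg`) and
`B7Prop1Explicit` (axial gauge `axialFn`, `axial_bond_bound`; (45) `bavg_gaugeAct`; `U1`) BY NAME; nothing edited or restated; 0 def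
(truncated fields and the axial-gauge generator are `let`-terms inside proofs).

PRINT.  [Balaban1985Averaging] p. 24 (after (43)): «this definition is local in the sense that `Ū^k_c` … depends only on the bond
variables `U_b` for `b ⊂ B^k(c₋) ∪ B^k(c₊)`»; (44) p. 24 `|V(∂p) − 1| < α₀`; pp. 24–25: the axial gauge `v₀` based at `y`, «for
`b ⊂ Δ(p′)` we have `|V₀,b − 1| < |b₋ − y|α₀`», «hence `V₀,b = e^{iA_b}`, … `|A_b| < 2dLα₀`»; (45) p. 24.  Gen 10 proved door (c) at
level 1 for backgrounds `(e^{B})^{u}` with a GLOBALLY small generator `B`; the axial-gauge bound grows with `|b₋ − y|`, so a genuine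
background is reached only through LOCALITY — this file.

WHAT THIS FILE PROVES ([folklore] bookkeeping + the lineage's kernel estimates; 0 sorry):
* §1 LOCALITY OF THE CURVATURE FUNCTIONAL: **`mlog_bavg_ratio_congr`** — `t ↦ log(Ū_c(e^{tA}U₀)·Ū_c(U₀)⁻¹)` is unchanged when `A`, `U₀`
  are modified off the bonds of `B(c₋) ∪ B(c₊)`; hence so are its quadratic term and the flat term (`iteratedDeriv_two_…_congr`).
* §2 FILES 16∕17 UNDER BLOCK-LOCAL HYPOTHESES (truncation): **`norm_curvature_sub_flat_le_local`**, **`norm_curvature_le_of_commute_local`**,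
  **`norm_curvature_gauge_le_of_commute_local`** (any background AGREEING on the block pair with `(e^{B})^{u}`).
* §3 THE PRINTED HYPOTHESIS (44), LOCAL: `U₀` unit-ball valued on the block pair with `‖U₀(∂p) − 1‖ ≤ α₀` for the unit plaquettes
  `p ⊂ B(c₋) ∪ B(c₊)`, `0 < α₀`, `ℓ(4dL+1)α₀ ≤ 1∕80` (`ℓ = 2dL+2L`), slot `‖A(b)‖ ≤ a` on the block pair, `0 < a`:
  **`norm_curvature_sub_axialFlat_le_of_plaq`** — `‖∂_t²|₀ log(Ū_c(e^{tA}U₀)Ū_c(U₀)⁻¹) − ∂_t²|₀ log Ū_c(e^{tA′})‖ ≤ 1024000·ℓ³·a²·(4dL+1)α₀`,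
  `A′ = v₀·A·v₀⁻¹` the slot transported to the axial gauge `v₀` (based at `c₋`) of the clamped `U₀`; and **`norm_curvature_le_of_plaq_oneSite`**
  — for a slot supported on the bonds at ONE site with pairwise commuting values (every one-parameter slot `s·X·δ_{b₀}`):
  `‖∂_t²|₀ log(Ū_c(e^{tA}U₀)Ū_c(U₀)⁻¹)‖ ≤ 1024000·ℓ³·a²·(4dL+1)α₀` — «DIAGONAL CURVATURE ∝ NON-FLATNESS `sup_{p ⊂ B(c₋)∪B(c₊)}‖U₀(∂p) − 1‖`»,
  the quantity of (44) itself, every hypothesis on the block pair only.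
Not done: the level-`j` version (files 10–12's recursion at a curved background); optimal constants; the RG densities (NODE O).

HONEST FRAMING.  [folklore] calculus∕bookkeeping over the lineage's verbatim ℤᵈ model of (42); nothing of Bałaban's asserted beyond
print; NE1′ NOT proved; spine 0∕9; (B) 0∕13; binders 0∕6; one fixed finite T⁴ — NOT ℝ⁴, NOT infinite volume, NOT a mass gap, NOT Clay.
-/

noncomputable section

open scoped Topology
open NormedSpace Filter Metric

namespace Summit.QuantumFields.BalabanUV.T4Continuum.NE1p.B7AveragingCommutator

open Literature.MathematicalPhysics.QuantumFieldTheory.Balaban1983to89.MatrixLog (mlog exp_mlog norm_mlog_le_two_mul)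
open Literature.MathematicalPhysics.QuantumFieldTheory.Balaban1983to89.B7Prop1Explicit
open Literature.MathematicalPhysics.QuantumFieldTheory.Balaban1983to89.B7Prop1Local (InBox AgreeOn bondHi bavg_congr clamp
  clampCfg clampCfg_agree clamp_inBox clamp_add_e_of norm_hol_plaqWord_clampCfg_le PlaqIn add_e_apply)
open Literature.MathematicalPhysics.QuantumFieldTheory.Balaban1983to89.B7Prop3Flat (expCfg)
open Literature.MathematicalPhysics.QuantumFieldTheory.Balaban1983to89.B7Prop3GeneralRotated (expCfg_zero)
open Literature.MathematicalPhysics.QuantumFieldTheory.Balaban1983to89.B8Ineq130 (bavg_one)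

variable {𝔸 : Type*} [NormedRing 𝔸] [NormedAlgebra ℂ 𝔸] [CompleteSpace 𝔸]

/-! ## §1 Locality of the curvature functional (p. 24) -/

section Locality

variable {d : ℕ} (L : ℕ)

/-- Slot fields agreeing on the bonds of a box give perturbed configurations `e^{tA}·U₀` agreeing there, for backgrounds agreeing there
((8)∕(42) are bondwise). [cite: Balaban1985Averaging, p.24 (sentence after (43))] -/
theorem agreeOn_expCfg_smul_mul {lo hi : Site d} {A A' : Site d → Fin d → 𝔸} {V V' : Site d → Fin d → 𝔸ˣ}
    (hA : ∀ (x : Site d) (μ : Fin d), InBox lo hi x → InBox lo hi (x + e μ) → A x μ = A' x μ) (hV : AgreeOn lo hi V V')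
    (t : ℂ) : AgreeOn lo hi (expCfg (t • A) * V) (expCfg (t • A') * V') := fun x μ hx hxe => by
  have h1 : expCfg (t • A) x μ = expCfg (t • A') x μ := by
    unfold expCfg; simp only [Pi.smul_apply, hA x μ hx hxe]
  simp only [Pi.mul_apply, h1, hV x μ hx hxe]

/-- The same without background: `e^{tA}` on the box depends only on `A` on the box. [cite: Balaban1985Averaging, p.24] -/
theorem agreeOn_expCfg_smul {lo hi : Site d} {A A' : Site d → Fin d → 𝔸}
    (hA : ∀ (x : Site d) (μ : Fin d), InBox lo hi x → InBox lo hi (x + e μ) → A x μ = A' x μ) (t : ℂ) :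
    AgreeOn lo hi (expCfg (t • A)) (expCfg (t • A')) := fun x μ hx hxe => by
  unfold expCfg; simp only [Pi.smul_apply, hA x μ hx hxe]

/-- **LOCALITY OF THE CURVATURE FUNCTIONAL**: `t ↦ log(Ū_c(e^{tA}U₀)·Ū_c(U₀)⁻¹)` is determined by `A` and `U₀` on the bonds of
`B(c₋) ∪ B(c₊)` (the lineage's kernel p. 24 locality `bavg_congr`, twice). [cite: Balaban1985Averaging, p.24 (sentence after (43)), (42) p.23] -/
theorem mlog_bavg_ratio_congr (hL : 1 ≤ L) (q : Site d) (κ : Fin d) {A A' : Site d → Fin d → 𝔸} {V V' : Site d → Fin d → 𝔸ˣ}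
    (hA : ∀ (x : Site d) (μ : Fin d), InBox q (bondHi L q κ) x → InBox q (bondHi L q κ) (x + e μ) → A x μ = A' x μ)
    (hV : AgreeOn q (bondHi L q κ) V V') :
    (fun t : ℂ => mlog (((bavg L (expCfg (t • A) * V) q κ * (bavg L V q κ)⁻¹ : 𝔸ˣ) : 𝔸)))
      = fun t : ℂ => mlog (((bavg L (expCfg (t • A') * V') q κ * (bavg L V' q κ)⁻¹ : 𝔸ˣ) : 𝔸)) := by
  funext t; rw [bavg_congr L hL q κ (agreeOn_expCfg_smul_mul hA hV t), bavg_congr L hL q κ hV]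

/-- Hence the QUADRATIC TERM `∂_t²|₀ log(Ū_c(e^{tA}U₀)Ū_c(U₀)⁻¹)` is determined by `A` and `U₀` on the block pair.
[cite: Balaban1985Averaging, p.24 (sentence after (43))] -/
theorem iteratedDeriv_two_mlog_bavg_ratio_congr (hL : 1 ≤ L) (q : Site d) (κ : Fin d) {A A' : Site d → Fin d → 𝔸}
    {V V' : Site d → Fin d → 𝔸ˣ}
    (hA : ∀ (x : Site d) (μ : Fin d), InBox q (bondHi L q κ) x → InBox q (bondHi L q κ) (x + e μ) → A x μ = A' x μ)
    (hV : AgreeOn q (bondHi L q κ) V V') :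
    iteratedDeriv 2 (fun t : ℂ => mlog (((bavg L (expCfg (t • A) * V) q κ * (bavg L V q κ)⁻¹ : 𝔸ˣ) : 𝔸))) 0
      = iteratedDeriv 2 (fun t : ℂ => mlog (((bavg L (expCfg (t • A') * V') q κ * (bavg L V' q κ)⁻¹ : 𝔸ˣ) : 𝔸))) 0 := by
  rw [mlog_bavg_ratio_congr L hL q κ hA hV]

/-- The flat term `∂_t²|₀ log Ū_c(e^{tA})` (files 8∕12) is determined by `A` on the block pair. [cite: Balaban1985Averaging, p.24] -/
theorem iteratedDeriv_two_mlog_bavg_expCfg_congr (hL : 1 ≤ L) (q : Site d) (κ : Fin d) {A A' : Site d → Fin d → 𝔸}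
    (hA : ∀ (x : Site d) (μ : Fin d), InBox q (bondHi L q κ) x → InBox q (bondHi L q κ) (x + e μ) → A x μ = A' x μ) :
    iteratedDeriv 2 (fun t : ℂ => mlog ((bavg L (expCfg (t • A)) q κ : 𝔸ˣ) : 𝔸)) 0
      = iteratedDeriv 2 (fun t : ℂ => mlog ((bavg L (expCfg (t • A')) q κ : 𝔸ˣ) : 𝔸)) 0 := by
  have e1 : (fun t : ℂ => mlog ((bavg L (expCfg (t • A)) q κ : 𝔸ˣ) : 𝔸))
      = fun t : ℂ => mlog ((bavg L (expCfg (t • A')) q κ : 𝔸ˣ) : 𝔸) := by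
    funext t; rw [bavg_congr L hL q κ (agreeOn_expCfg_smul hA t)]
  rw [e1]

omit [NormedAlgebra ℂ 𝔸] [CompleteSpace 𝔸] in
/-- (8) is bondwise: backgrounds agreeing on a box have gauge transforms agreeing on the box. [cite: Balaban1985Averaging, (8) p.18] -/
theorem agreeOn_gaugeAct {lo hi : Site d} (u : Site d → 𝔸ˣ) {V V' : Site d → Fin d → 𝔸ˣ} (hV : AgreeOn lo hi V V') :
    AgreeOn lo hi (gaugeAct u V) (gaugeAct u V') := fun x μ hx hxe => by
  simp only [gaugeAct, hV x μ hx hxe]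

end Locality

/-! ## §2 Files 16∕17 under hypotheses on the block pair only (truncation off the block pair) -/

section Local

variable {d : ℕ} (L : ℕ) {A B : Site d → Fin d → 𝔸} {a b : ℝ}

omit [NormedAlgebra ℂ 𝔸] [CompleteSpace 𝔸] in
/-- Truncation bookkeeping: `‖(P ? X : 0)‖ ≤ a` if `‖X‖ ≤ a` under `P` and `0 ≤ a`. [folklore] -/
theorem norm_ite_zero_le_of {P : Prop} [Decidable P] {X : 𝔸} (h : P → ‖X‖ ≤ a) (ha : 0 ≤ a) :
    ‖(if P then X else 0)‖ ≤ a := by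
  split_ifs with hP; exacts [h hP, by rw [norm_zero]; exact ha]

omit [NormedAlgebra ℂ 𝔸] [CompleteSpace 𝔸] in
/-- Truncation bookkeeping: truncated values commute when the kept ones do. [folklore] -/
theorem commute_ite_zero_of {P Q : Prop} [Decidable P] [Decidable Q] {X Y : 𝔸} (h : P → Q → Commute X Y) :
    Commute (if P then X else 0) (if Q then Y else 0) := by
  split_ifs with hP hQ
  exacts [h hP hQ, Commute.zero_right _, Commute.zero_left _, Commute.zero_left _]

/-- **FILE 16 BLOCK-LOCALLY**: `‖∂_t²|₀ log(Ū_c(e^{tA}e^{B})·Ū_c(e^{B})⁻¹) − ∂_t²|₀ log Ū_c(e^{tA})‖ ≤ 1024000·ℓ³·a²·b` assuming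
`‖A(b′)‖ ≤ a`, `‖B(b′)‖ ≤ b` ONLY for the bonds `b′ ⊂ B(c₋) ∪ B(c₊)` (`0 < a`, `0 < b`, `ℓ·b ≤ 1∕80`): both sides are unchanged when
`A`, `B` are truncated to the block pair (§1), and the truncations satisfy file 16's global hypotheses. [cite: Balaban1985Averaging, p.24 (sentence after (43)), (42) p.23] -/
theorem norm_curvature_sub_flat_le_local (hL : 1 ≤ L) (q : Site d) (κ : Fin d) (ha0 : 0 < a) (hb0 : 0 < b)
    (ha : ∀ (x : Site d) (μ : Fin d), InBox q (bondHi L q κ) x → InBox q (bondHi L q κ) (x + e μ) → ‖A x μ‖ ≤ a)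
    (hb : ∀ (x : Site d) (μ : Fin d), InBox q (bondHi L q κ) x → InBox q (bondHi L q κ) (x + e μ) → ‖B x μ‖ ≤ b)
    (hB : (2 * d * L + 2 * L) * b ≤ 1 / 80) :
    ‖iteratedDeriv 2 (fun u : ℂ =>
          mlog (((bavg L (expCfg (u • A) * expCfg B) q κ * (bavg L (expCfg B) q κ)⁻¹ : 𝔸ˣ) : 𝔸))) 0
        - iteratedDeriv 2 (fun u : ℂ => mlog ((bavg L (expCfg (u • A)) q κ : 𝔸ˣ) : 𝔸)) 0‖
      ≤ 1024000 * (2 * d * L + 2 * L) ^ 3 * a ^ 2 * b := by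
  classical
  set lo := q
  set hi := bondHi L q κ
  let At : Site d → Fin d → 𝔸 := fun x μ => if InBox lo hi x ∧ InBox lo hi (x + e μ) then A x μ else 0
  let Bt : Site d → Fin d → 𝔸 := fun x μ => if InBox lo hi x ∧ InBox lo hi (x + e μ) then B x μ else 0
  have hAt : ∀ (x : Site d) (μ : Fin d), InBox lo hi x → InBox lo hi (x + e μ) → A x μ = At x μ := fun x μ hx hxe => by
    simp only [At, hx, hxe, and_self, if_true]
  have hBt : ∀ (x : Site d) (μ : Fin d), InBox lo hi x → InBox lo hi (x + e μ) → B x μ = Bt x μ := fun x μ hx hxe => by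
    simp only [Bt, hx, hxe, and_self, if_true]
  have hat : ∀ (x : Site d) (μ : Fin d), ‖At x μ‖ ≤ a := fun x μ => norm_ite_zero_le_of (fun h => ha x μ h.1 h.2) ha0.le
  have hbt : ∀ (x : Site d) (μ : Fin d), ‖Bt x μ‖ ≤ b := fun x μ => norm_ite_zero_le_of (fun h => hb x μ h.1 h.2) hb0.le
  have hV : AgreeOn lo hi (expCfg B) (expCfg Bt) := fun x μ hx hxe => by
    unfold expCfg; simp only [hBt x μ hx hxe]
  rw [iteratedDeriv_two_mlog_bavg_ratio_congr L hL q κ hAt hV, iteratedDeriv_two_mlog_bavg_expCfg_congr L hL q κ hAt]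
  exact norm_curvature_sub_flat_le hat hbt ha0 hb0 L hL hB q κ

/-- **«DIAGONAL CURVATURE ∝ NON-FLATNESS» AT LEVEL 1, BLOCK-LOCALLY**: if the values of `A` on the bonds of `B(c₋) ∪ B(c₊)` pairwise
commute (every one-parameter slot) and `‖A‖ ≤ a`, `‖B‖ ≤ b` there (`0 < a`, `0 < b`, `ℓ·b ≤ 1∕80`), then
`‖∂_t²|₀ log(Ū_c(e^{tA}e^{B})·Ū_c(e^{B})⁻¹)‖ ≤ 1024000·ℓ³·a²·b`. [cite: Balaban1985Averaging, p.24 (sentence after (43)), (42) p.23] -/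
theorem norm_curvature_le_of_commute_local (hL : 1 ≤ L) (q : Site d) (κ : Fin d) (ha0 : 0 < a) (hb0 : 0 < b)
    (ha : ∀ (x : Site d) (μ : Fin d), InBox q (bondHi L q κ) x → InBox q (bondHi L q κ) (x + e μ) → ‖A x μ‖ ≤ a)
    (hb : ∀ (x : Site d) (μ : Fin d), InBox q (bondHi L q κ) x → InBox q (bondHi L q κ) (x + e μ) → ‖B x μ‖ ≤ b)
    (hB : (2 * d * L + 2 * L) * b ≤ 1 / 80)
    (hA : ∀ (x : Site d) (μ : Fin d) (y : Site d) (ν : Fin d), InBox q (bondHi L q κ) x → InBox q (bondHi L q κ) (x + e μ) →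
      InBox q (bondHi L q κ) y → InBox q (bondHi L q κ) (y + e ν) → Commute (A x μ) (A y ν)) :
    ‖iteratedDeriv 2 (fun u : ℂ =>
          mlog (((bavg L (expCfg (u • A) * expCfg B) q κ * (bavg L (expCfg B) q κ)⁻¹ : 𝔸ˣ) : 𝔸))) 0‖
      ≤ 1024000 * (2 * d * L + 2 * L) ^ 3 * a ^ 2 * b := by
  classical
  set lo := q
  set hi := bondHi L q κ
  let At : Site d → Fin d → 𝔸 := fun x μ => if InBox lo hi x ∧ InBox lo hi (x + e μ) then A x μ else 0
  let Bt : Site d → Fin d → 𝔸 := fun x μ => if InBox lo hi x ∧ InBox lo hi (x + e μ) then B x μ else 0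
  have hAt : ∀ (x : Site d) (μ : Fin d), InBox lo hi x → InBox lo hi (x + e μ) → A x μ = At x μ := fun x μ hx hxe => by
    simp only [At, hx, hxe, and_self, if_true]
  have hBt : ∀ (x : Site d) (μ : Fin d), InBox lo hi x → InBox lo hi (x + e μ) → B x μ = Bt x μ := fun x μ hx hxe => by
    simp only [Bt, hx, hxe, and_self, if_true]
  have hat : ∀ (x : Site d) (μ : Fin d), ‖At x μ‖ ≤ a := fun x μ => norm_ite_zero_le_of (fun h => ha x μ h.1 h.2) ha0.le
  have hbt : ∀ (x : Site d) (μ : Fin d), ‖Bt x μ‖ ≤ b := fun x μ => norm_ite_zero_le_of (fun h => hb x μ h.1 h.2) hb0.le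
  have hAt' : ∀ (x : Site d) (μ : Fin d) (y : Site d) (ν : Fin d), Commute (At x μ) (At y ν) := fun x μ y ν =>
    commute_ite_zero_of fun h h' => hA x μ y ν h.1 h.2 h'.1 h'.2
  have hV : AgreeOn lo hi (expCfg B) (expCfg Bt) := fun x μ hx hxe => by
    unfold expCfg; simp only [hBt x μ hx hxe]
  rw [iteratedDeriv_two_mlog_bavg_ratio_congr L hL q κ hAt hV]
  exact norm_curvature_le_of_commute hat hbt ha0 hb0 L hL hB hAt' q κ

variable [NormOneClass 𝔸]

/-- **FILE 17 BLOCK-LOCALLY**: for every background `U₀` AGREEING ON THE BONDS OF `B(c₋) ∪ B(c₊)` with a gauge transform `(e^{B})^{u}`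
(`u` unit-ball valued) of a connection with `‖B(b′)‖ ≤ b` on the block pair (`0 < b`, `ℓ·b ≤ 1∕80`), and every slot `A = u·A′·u⁻¹`
whose transported values `A′` on the block pair have norm `≤ a` (`0 < a`) and pairwise commute (every one-parameter slot):
`‖∂_t²|₀ log(Ū_c(e^{tA}U₀)·Ū_c(U₀)⁻¹)‖ ≤ 1024000·ℓ³·a²·b`. [cite: Balaban1985Averaging, p.24 (sentence after (43)), (45) p.24, (42) p.23] -/
theorem norm_curvature_gauge_le_of_commute_local (hL : 1 ≤ L) (q : Site d) (κ : Fin d) {u : Site d → 𝔸ˣ}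
    (hu : ∀ x, u x ∈ U1 𝔸) {A' : Site d → Fin d → 𝔸}
    (hAA' : ∀ (x : Site d) (μ : Fin d), A x μ = (u x : 𝔸) * A' x μ * (((u x)⁻¹ : 𝔸ˣ) : 𝔸))
    {U₀ : Site d → Fin d → 𝔸ˣ} (hU₀ : AgreeOn q (bondHi L q κ) U₀ (gaugeAct u (expCfg B))) (ha0 : 0 < a) (hb0 : 0 < b)
    (ha : ∀ (x : Site d) (μ : Fin d), InBox q (bondHi L q κ) x → InBox q (bondHi L q κ) (x + e μ) → ‖A' x μ‖ ≤ a)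
    (hb : ∀ (x : Site d) (μ : Fin d), InBox q (bondHi L q κ) x → InBox q (bondHi L q κ) (x + e μ) → ‖B x μ‖ ≤ b)
    (hB : (2 * d * L + 2 * L) * b ≤ 1 / 80)
    (hA' : ∀ (x : Site d) (μ : Fin d) (y : Site d) (ν : Fin d), InBox q (bondHi L q κ) x → InBox q (bondHi L q κ) (x + e μ) →
      InBox q (bondHi L q κ) y → InBox q (bondHi L q κ) (y + e ν) → Commute (A' x μ) (A' y ν)) :
    ‖iteratedDeriv 2 (fun t : ℂ =>
          mlog (((bavg L (expCfg (t • A) * U₀) q κ * (bavg L U₀ q κ)⁻¹ : 𝔸ˣ) : 𝔸))) 0‖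
      ≤ 1024000 * (2 * d * L + 2 * L) ^ 3 * a ^ 2 * b := by
  classical
  set lo := q
  set hi := bondHi L q κ
  let A't : Site d → Fin d → 𝔸 := fun x μ => if InBox lo hi x ∧ InBox lo hi (x + e μ) then A' x μ else 0
  let At : Site d → Fin d → 𝔸 := fun x μ => (u x : 𝔸) * A't x μ * (((u x)⁻¹ : 𝔸ˣ) : 𝔸)
  let Bt : Site d → Fin d → 𝔸 := fun x μ => if InBox lo hi x ∧ InBox lo hi (x + e μ) then B x μ else 0
  have hAAt : ∀ (x : Site d) (μ : Fin d), At x μ = (u x : 𝔸) * A't x μ * (((u x)⁻¹ : 𝔸ˣ) : 𝔸) := fun x μ => rfl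
  have hAt : ∀ (x : Site d) (μ : Fin d), InBox lo hi x → InBox lo hi (x + e μ) → A x μ = At x μ := fun x μ hx hxe => by
    simp only [At, A't, hx, hxe, and_self, if_true, hAA' x μ]
  have hBt : ∀ (x : Site d) (μ : Fin d), InBox lo hi x → InBox lo hi (x + e μ) → B x μ = Bt x μ := fun x μ hx hxe => by
    simp only [Bt, hx, hxe, and_self, if_true]
  have hat : ∀ (x : Site d) (μ : Fin d), ‖A't x μ‖ ≤ a := fun x μ => norm_ite_zero_le_of (fun h => ha x μ h.1 h.2) ha0.le
  have hbt : ∀ (x : Site d) (μ : Fin d), ‖Bt x μ‖ ≤ b := fun x μ => norm_ite_zero_le_of (fun h => hb x μ h.1 h.2) hb0.le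
  have hAt' : ∀ (x : Site d) (μ : Fin d) (y : Site d) (ν : Fin d), Commute (A't x μ) (A't y ν) := fun x μ y ν =>
    commute_ite_zero_of fun h h' => hA' x μ y ν h.1 h.2 h'.1 h'.2
  have hV : AgreeOn lo hi U₀ (gaugeAct u (expCfg Bt)) := fun x μ hx hxe => by
    rw [hU₀ x μ hx hxe]
    refine agreeOn_gaugeAct u (fun y ν hy hye => ?_) x μ hx hxe
    unfold expCfg; simp only [hBt y ν hy hye]
  rw [iteratedDeriv_two_mlog_bavg_ratio_congr L hL q κ hAt hV]
  exact norm_curvature_gaugeOrbit_le_of_commute L hu hAAt hat hbt ha0.le hb0.le hL ha0 hb0 hB hAt' q κ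

end Local

/-! ## §3 The printed hypothesis (44) on the block pair: axial gauge + locality -/

section Plaquette

variable {d : ℕ} (L : ℕ) [NormOneClass 𝔸]

omit [NormedAlgebra ℂ 𝔸] [CompleteSpace 𝔸] in
/-- The clamped extension of a configuration unit-ball valued ON THE BONDS OF THE BOX is unit-ball valued everywhere (it reads `V` only on
bonds of the box and is `1` elsewhere). [folklore] -/
theorem clampCfg_mem_U1_of_local {lo hi : Site d} (hlohi : ∀ i, lo i ≤ hi i) {V : Site d → Fin d → 𝔸ˣ}
    (hV : ∀ (x : Site d) (μ : Fin d), InBox lo hi x → InBox lo hi (x + e μ) → V x μ ∈ U1 𝔸) (x : Site d) (μ : Fin d) :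
    clampCfg lo hi V x μ ∈ U1 𝔸 := by
  unfold clampCfg
  split_ifs with h
  · refine hV _ μ (clamp_inBox hlohi x) ?_
    rw [← clamp_add_e_of h]; exact clamp_inBox hlohi _
  · exact (U1 𝔸).one_mem

omit [NormOneClass 𝔸] [NormedAlgebra ℂ 𝔸] [CompleteSpace 𝔸] in
/-- On the block pair `[q, q + (L−1)𝟙 + Le_κ]` the `ℓ¹` distance to `c₋ = q` is at most `2dL`. [folklore] -/
theorem l1_sub_le_two_mul_of_inBox_bondHi {q x : Site d} {κ : Fin d} (hx : InBox q (bondHi L q κ) x) :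
    (l1 (x - q) : ℝ) ≤ 2 * d * L := by
  have h1 : l1 (x - q) ≤ d * (2 * L) := by
    unfold l1
    have hb : ∀ i ∈ (Finset.univ : Finset (Fin d)), ((x - q) i).natAbs ≤ 2 * L := fun i _ => by
      have := hx i
      simp only [bondHi] at this
      simp only [Pi.sub_apply]
      split_ifs at this <;> omega
    have := Finset.sum_le_card_nsmul _ _ _ hb
    simpa using this
  calc (l1 (x - q) : ℝ) ≤ ((d * (2 * L) : ℕ) : ℝ) := by exact_mod_cast h1
    _ = 2 * d * L := by push_cast; ring

/-- **DOOR (c) AT LEVEL 1 UNDER THE PRINTED LOCAL HYPOTHESIS (44)** — general slot.  `c = ⟨q, q + Le_κ⟩`, `ℓ = 2dL+2L`, `L ≥ 1`;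
`U₀` unit-ball valued on the bonds of `B(c₋) ∪ B(c₊)` with `‖U₀(∂p) − 1‖ ≤ α₀` for the unit plaquettes `p ⊂ B(c₋) ∪ B(c₊)`, `0 < α₀`,
`ℓ(4dL+1)α₀ ≤ 1∕80`; slot `‖A(b)‖ ≤ a` on the block pair, `0 < a`; `v₀` = the axial gauge (p. 24) based at `c₋` of the clamped extension of
`U₀|_{B(c₋)∪B(c₊)}`, `A′ = v₀·A·v₀⁻¹`:  `‖∂_t²|₀ log(Ū_c(e^{tA}U₀)·Ū_c(U₀)⁻¹) − ∂_t²|₀ log Ū_c(e^{tA′})‖ ≤ 1024000·ℓ³·a²·((4dL+1)·α₀)`.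
Route: `U₀ ≡ π^*U₀ =: W` on the block pair, all plaquette variables of `W` within `α₀` of `1` (`norm_hol_plaqWord_clampCfg_le`); axial gauge
`V₀ = W^{v₀}`, `‖V₀(b) − 1‖ ≤ |b₋ − c₋|₁·α₀ ≤ 2dL·α₀` on the block pair (`axial_bond_bound`), `B := log V₀` there, `e^{B} = V₀` ((21)∕(23));
`U₀ ≡ (e^{B})^{v₀⁻¹}` on the block pair; §1, file 17's covariance identity, file 16's estimate for the transported truncated slot (`v₀(c₋) = 1`).
[cite: Balaban1985Averaging, (44) p.24, pp.24–25, (45) p.24, (42) p.23] -/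
theorem norm_curvature_sub_axialFlat_le_of_plaq (hL : 1 ≤ L) (q : Site d) (κ : Fin d) {U₀ : Site d → Fin d → 𝔸ˣ}
    (hU₀ : ∀ (x : Site d) (μ : Fin d), InBox q (bondHi L q κ) x → InBox q (bondHi L q κ) (x + e μ) → U₀ x μ ∈ U1 𝔸)
    {α₀ : ℝ} (hα₀ : 0 < α₀)
    (h44 : ∀ (x : Site d) (μ ν : Fin d), μ ≠ ν → PlaqIn q (bondHi L q κ) (x, μ, ν) →
      ‖((hol U₀ x (plaqWord μ ν) : 𝔸ˣ) : 𝔸) - 1‖ ≤ α₀)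
    (hsmall : (2 * d * L + 2 * L) * ((4 * d * L + 1) * α₀) ≤ 1 / 80)
    {A : Site d → Fin d → 𝔸} {a : ℝ} (ha0 : 0 < a)
    (ha : ∀ (x : Site d) (μ : Fin d), InBox q (bondHi L q κ) x → InBox q (bondHi L q κ) (x + e μ) → ‖A x μ‖ ≤ a) :
    ‖iteratedDeriv 2 (fun t : ℂ =>
          mlog (((bavg L (expCfg (t • A) * U₀) q κ * (bavg L U₀ q κ)⁻¹ : 𝔸ˣ) : 𝔸))) 0
        - iteratedDeriv 2 (fun t : ℂ => mlog ((bavg L (expCfg (t • fun x μ =>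
            ((axialFn (clampCfg q (bondHi L q κ) U₀) q x : 𝔸ˣ) : 𝔸) * A x μ
              * (((axialFn (clampCfg q (bondHi L q κ) U₀) q x)⁻¹ : 𝔸ˣ) : 𝔸))) q κ : 𝔸ˣ) : 𝔸)) 0‖
      ≤ 1024000 * (2 * d * L + 2 * L) ^ 3 * a ^ 2 * ((4 * d * L + 1) * α₀) := by
  classical
  have hlohi : ∀ i, q i ≤ bondHi L q κ i := fun i => by
    simp only [bondHi]; split_ifs <;> omega
  -- (i) the clamped extension
  set W := clampCfg q (bondHi L q κ) U₀
  have hWU : AgreeOn q (bondHi L q κ) W U₀ := clampCfg_agree U₀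
  have hWm : ∀ x μ, W x μ ∈ U1 𝔸 := clampCfg_mem_U1_of_local hlohi hU₀
  have h44W : ∀ (x : Site d) (μ ν : Fin d), μ ≠ ν → ‖((hol W x (plaqWord μ ν) : 𝔸ˣ) : 𝔸) - 1‖ ≤ α₀ :=
    fun x μ ν hμν => norm_hol_plaqWord_clampCfg_le hlohi U₀ hμν hα₀.le (fun y hy => h44 y μ ν hμν hy) x
  -- (ii) the axial gauge based at `c₋`
  set v : Site d → 𝔸ˣ := axialFn W q with hv
  have hvm : ∀ x, v x ∈ U1 𝔸 := fun x => axialFn_mem hWm q x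
  have hvq : v q = 1 := by simp [hv, axialFn]
  set V₀ := gaugeAct v W with hV₀
  have hV₀b : ∀ (x : Site d) (μ : Fin d), InBox q (bondHi L q κ) x → ‖((V₀ x μ : 𝔸ˣ) : 𝔸) - 1‖ ≤ 2 * d * L * α₀ := fun x μ hx => by
    have h := axial_bond_bound W hWm q h44W hα₀.le x μ
    exact h.trans (mul_le_mul_of_nonneg_right (l1_sub_le_two_mul_of_inBox_bondHi L hx) hα₀.le)
  have hL1 : (1 : ℝ) ≤ L := by exact_mod_cast hL
  have hdL : (0 : ℝ) ≤ 2 * d * L * α₀ := by positivity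
  have hsmall' : (4 * d * L + 1) * α₀ ≤ 1 / 160 := by
    have : 2 * ((4 * d * L + 1) * α₀) ≤ (2 * d * L + 2 * L) * ((4 * d * L + 1) * α₀) :=
      mul_le_mul_of_nonneg_right (by nlinarith) (by positivity)
    linarith
  have h2dL : 2 * d * L * α₀ ≤ 1 / 160 := by nlinarith
  have hb0 : 0 < (4 * d * L + 1) * α₀ := by positivity
  -- the generator `B = log V₀` on the block pair
  let B : Site d → Fin d → 𝔸 := fun x μ =>
    if InBox q (bondHi L q κ) x ∧ InBox q (bondHi L q κ) (x + e μ) then mlog ((V₀ x μ : 𝔸ˣ) : 𝔸) else 0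
  have hBb : ∀ (x : Site d) (μ : Fin d), ‖B x μ‖ ≤ (4 * d * L + 1) * α₀ := fun x μ =>
    norm_ite_zero_le_of (fun h => (norm_mlog_le_two_mul ((hV₀b x μ h.1).trans (by linarith))).trans
      (by nlinarith [hV₀b x μ h.1])) hb0.le
  have hBV₀ : AgreeOn q (bondHi L q κ) (expCfg B) V₀ := fun x μ hx hxe => by
    apply Units.ext
    have h1 := hV₀b x μ hx
    show exp (B x μ) = ((V₀ x μ : 𝔸ˣ) : 𝔸)
    simp only [B, hx, hxe, and_self, if_true]
    exact exp_mlog (h1.trans_lt (by linarith))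
  -- (iii) `U₀ ≡ (e^{B})^{v⁻¹}` on the block pair
  have hWV : W = gaugeAct (fun x => (v x)⁻¹) V₀ := by
    funext x μ; simp only [hV₀, gaugeAct, inv_inv]; group
  have hU₀' : AgreeOn q (bondHi L q κ) U₀ (gaugeAct (fun x => (v x)⁻¹) (expCfg B)) := fun x μ hx hxe => by
    rw [← hWU x μ hx hxe, hWV]
    exact agreeOn_gaugeAct _ hBV₀.symm x μ hx hxe
  have hum : ∀ x, (v x)⁻¹ ∈ U1 𝔸 := fun x => (U1 𝔸).inv_mem (hvm x)
  -- truncate the slot, transport it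
  let At : Site d → Fin d → 𝔸 := fun x μ => if InBox q (bondHi L q κ) x ∧ InBox q (bondHi L q κ) (x + e μ) then A x μ else 0
  let A't : Site d → Fin d → 𝔸 := fun x μ => (v x : 𝔸) * At x μ * (((v x)⁻¹ : 𝔸ˣ) : 𝔸)
  have hAt : ∀ (x : Site d) (μ : Fin d), InBox q (bondHi L q κ) x → InBox q (bondHi L q κ) (x + e μ) → A x μ = At x μ := fun x μ hx hxe => by
    simp only [At, hx, hxe, and_self, if_true]
  have hAAt : ∀ (x : Site d) (μ : Fin d), At x μ = (((v x)⁻¹ : 𝔸ˣ) : 𝔸) * A't x μ * ((((v x)⁻¹)⁻¹ : 𝔸ˣ) : 𝔸) := fun x μ => by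
    simp only [A't, inv_inv, ← mul_assoc, Units.inv_mul, one_mul, Units.inv_mul_cancel_right]
  have hat : ∀ (x : Site d) (μ : Fin d), ‖A't x μ‖ ≤ a := fun x μ => by
    have hAt0 : ‖At x μ‖ ≤ a := norm_ite_zero_le_of (fun h => ha x μ h.1 h.2) ha0.le
    calc ‖A't x μ‖ ≤ ‖(v x : 𝔸) * At x μ‖ * ‖(((v x)⁻¹ : 𝔸ˣ) : 𝔸)‖ := norm_mul_le _ _
      _ ≤ (‖(v x : 𝔸)‖ * ‖At x μ‖) * 1 :=
          mul_le_mul (norm_mul_le _ _) (hvm x).2 (norm_nonneg _) (by positivity)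
      _ ≤ (1 * a) * 1 := by gcongr; exact (hvm x).1
      _ = a := by ring
  -- the transported-flat term is the one in the statement, by locality
  have hflat : iteratedDeriv 2 (fun t : ℂ => mlog ((bavg L (expCfg (t • fun x μ =>
        (v x : 𝔸) * A x μ * (((v x)⁻¹ : 𝔸ˣ) : 𝔸))) q κ : 𝔸ˣ) : 𝔸)) 0
      = iteratedDeriv 2 (fun t : ℂ => mlog ((bavg L (expCfg (t • A't)) q κ : 𝔸ˣ) : 𝔸)) 0 := by
    refine iteratedDeriv_two_mlog_bavg_expCfg_congr L hL q κ fun x μ hx hxe => ?_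
    simp only [A't, ← hAt x μ hx hxe]
  -- assemble
  rw [iteratedDeriv_two_mlog_bavg_ratio_congr L hL q κ hAt hU₀', hflat,
    iteratedDeriv_two_mlog_bavg_gauge_ratio L hum hAAt hat hBb ha0.le hb0.le hL (by linarith) q κ]
  simp only [hvq, inv_one, Units.val_one, one_mul, mul_one]
  exact norm_curvature_sub_flat_le hat hBb ha0 hb0 L hL hsmall q κ

/-- **«DIAGONAL CURVATURE ∝ NON-FLATNESS» AT LEVEL 1, THE NON-FLATNESS BEING `sup_{p ⊂ B(c₋)∪B(c₊)} ‖U₀(∂p) − 1‖` OF (44)**: under the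
hypotheses of `norm_curvature_sub_axialFlat_le_of_plaq`, if the slot `A` is supported on the bonds at ONE site `x₀` with pairwise commuting
values there (every one-parameter slot `s·X·δ_{b₀}`), then
`‖∂_t²|₀ log(Ū_c(e^{tA}U₀)·Ū_c(U₀)⁻¹)‖ ≤ 1024000·ℓ³·a²·((4dL+1)·α₀)` — linear in the plaquette deviation `α₀`, quadratic in the slot
amplitude, hypotheses on `B(c₋) ∪ B(c₊)` only (the transported slot is again one-site with commuting values: flat term `0`, file 8).
[cite: Balaban1985Averaging, (44) p.24, pp.24–25, (45) p.24, (42) p.23] -/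
theorem norm_curvature_le_of_plaq_oneSite (hL : 1 ≤ L) (q : Site d) (κ : Fin d) {U₀ : Site d → Fin d → 𝔸ˣ}
    (hU₀ : ∀ (x : Site d) (μ : Fin d), InBox q (bondHi L q κ) x → InBox q (bondHi L q κ) (x + e μ) → U₀ x μ ∈ U1 𝔸)
    {α₀ : ℝ} (hα₀ : 0 < α₀)
    (h44 : ∀ (x : Site d) (μ ν : Fin d), μ ≠ ν → PlaqIn q (bondHi L q κ) (x, μ, ν) →
      ‖((hol U₀ x (plaqWord μ ν) : 𝔸ˣ) : 𝔸) - 1‖ ≤ α₀)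
    (hsmall : (2 * d * L + 2 * L) * ((4 * d * L + 1) * α₀) ≤ 1 / 80)
    {A : Site d → Fin d → 𝔸} {a : ℝ} (ha0 : 0 < a)
    (ha : ∀ (x : Site d) (μ : Fin d), InBox q (bondHi L q κ) x → InBox q (bondHi L q κ) (x + e μ) → ‖A x μ‖ ≤ a)
    (x₀ : Site d) (hsupp : ∀ (x : Site d) (μ : Fin d), x ≠ x₀ → A x μ = 0)
    (hcomm : ∀ (μ ν : Fin d), Commute (A x₀ μ) (A x₀ ν)) :
    ‖iteratedDeriv 2 (fun t : ℂ =>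
          mlog (((bavg L (expCfg (t • A) * U₀) q κ * (bavg L U₀ q κ)⁻¹ : 𝔸ˣ) : 𝔸))) 0‖
      ≤ 1024000 * (2 * d * L + 2 * L) ^ 3 * a ^ 2 * ((4 * d * L + 1) * α₀) := by
  have h := norm_curvature_sub_axialFlat_le_of_plaq L hL q κ hU₀ hα₀ h44 hsmall ha0 ha
  set v : Site d → 𝔸ˣ := axialFn (clampCfg q (bondHi L q κ) U₀) q
  have hA' : ∀ (x : Site d) (μ : Fin d) (y : Site d) (ν : Fin d),
      Commute ((v x : 𝔸) * A x μ * (((v x)⁻¹ : 𝔸ˣ) : 𝔸)) ((v y : 𝔸) * A y ν * (((v y)⁻¹ : 𝔸ˣ) : 𝔸)) := by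
    intro x μ y ν
    by_cases hx : x = x₀
    · by_cases hy : y = x₀
      · rw [hx, hy]
        have hc := (hcomm μ ν).eq
        show _ * _ = _ * _
        simp only [mul_assoc, Units.inv_mul_cancel_left]
        rw [← mul_assoc (A x₀ μ), hc, mul_assoc]
      · rw [hsupp y ν hy, mul_zero, zero_mul]; exact Commute.zero_right _
    · rw [hsupp x μ hx, mul_zero, zero_mul]; exact Commute.zero_left _
  rwa [iteratedDeriv_two_mlog_bavg_expCfg_of_commute L hA' q κ, sub_zero] at h

end Plaquette

end Summit.QuantumFields.BalabanUV.T4Continuum.NE1p.B7AveragingCommutator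

end
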